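import Summits.Ventures.HSemireg.WedgeHankelRecurrenceGaussChebyshevSCharPTable

/-!
# Venture HSemireg — **THE MONIC NESTING LAW `S_{mn−1} = S_{m−1}(C_n) · S_{n−1}` FOR ALL `m, n ∈ ℤ` IN EVERY COMMUTATIVE RING** (both indices may be negative: `S_{−k−2} = −S_k`, `C_{−n} = C_n`),
# hence `S_{n−1} ∣ S_{mn−1}` and nested zero sets; the Vieta-normalised companion of N438 `U_{k(n+1)−1} = U_{k−1}(T_{n+1}) U_n` (there `k ∈ ℕ`, via the Literature explicit form), here proved for
# `m ∈ ℤ` by the two-sided Chebyshev induction from the product formula `C_n S_k = S_{k+n} + S_{k−n}` (N481); with Mathlib's `C_{mn} = C_m ∘ C_n` (`C_mul`) this is the polynomial content of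
# Lehmer's subsequence law `U_{mn} = U_n · U_m(V_n, Q^n)`, `V_{mn} = V_m(V_n, Q^n)` (integer forms: `Literature.NumberTheory.LucasSequences.Subsequences`, not restated)

HONEST FRAMING. Part of the Lean index of the computation cell `pub-hsemireg` (seat p10 gen 48, Sunday typer «UNIFORM-IN-n»).  Polynomial algebra only; no variety, no cohomology theory, no sheaf,
no Ext group and no semiregularity map is constructed here; nothing here says that HC / HC_CM / HC_AV holds; no Literature fact (unproved `Prop`) is declared or used.  Custodian versions as in
`WedgeHankelSiegelIdeal` (1/3).
SOURCES (cited).  D. H. Lehmer, Ann. of Math. 31 (1930) 419–448, §2; R. Lidl, G. L. Mullen, G. Turnwald, *Dickson Polynomials* (1993), Lemma 2.3 ∕ Ch. 2 (`E_{mn−1}`); J. C. Mason, D. C. Handscomb,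
*Chebyshev Polynomials* (2003), §1.2.2.
PROOF TYPED HERE.  N481 `chebyshevC_mul_S`; Mathlib `Polynomial.Chebyshev.induct`, `S_add_two`, `S_sub_one`, `S_zero ∕ S_one ∕ S_neg_one`, `add_comp ∕ sub_comp ∕ mul_comp ∕ X_comp`, `eval_comp`.
DEDUP DISCLOSURE (`rg -n 'chebyshevS_mul_pred_eq_comp|chebyshevS_dvd_S_mul_pred|chebyshevS_eval_eq_zero_of_eval_eq_zero|chebyshevS_mul_pred_eval' Summits Literature HarnessLib`, 2026-09-04): N438
`chebyshevU_mul_pred_eq_comp` (`U`-form, `k ∈ ℕ`), `Literature…ChebyshevExplicitForms.U_mul_sub_one_eq_comp_mul`; Mathlib `C_mul` (`C_{mn} = C_m ∘ C_n`); 0 hits for the 4 names below.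

WHAT IS IN THE TREE.  N438, N481; Mathlib `C_mul`.
THIS FILE (namespace `Summit.Ventures.HSemireg.Wedge.HankelOuter` continued; CHAINED on N486; 0 definitions):
* §1252 **`chebyshevS_mul_pred_eq_comp`** (all `m, n ∈ ℤ`), `chebyshevS_dvd_S_mul_pred`, `chebyshevS_eval_eq_zero_of_eval_eq_zero`, `chebyshevS_mul_pred_eval`.
CAVEATS.  Nothing Ext-side.  New names only.
-/

open Module Polynomial
open scoped Matrix Polynomial

namespace Summit.Ventures.HSemireg.Wedge.HankelOuter

/-! ## §1252. `S_{mn−1} = S_{m−1}(C_n) S_{n−1}` -/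

/-- **`S_{mn−1} = S_{m−1}(C_n) · S_{n−1}` for all `m, n ∈ ℤ`** in every commutative ring. [Lidl–Mullen–Turnwald Lemma 2.3; Lehmer 1930 §2; this file, §1252] -/
theorem chebyshevS_mul_pred_eq_comp {R : Type*} [CommRing R] (m n : ℤ) :
    Polynomial.Chebyshev.S R (m * n - 1) = (Polynomial.Chebyshev.S R (m - 1)).comp (Polynomial.Chebyshev.C R n) * Polynomial.Chebyshev.S R (n - 1) := by
  induction m using Polynomial.Chebyshev.induct with
  | zero => rw [zero_mul, zero_sub, Polynomial.Chebyshev.S_neg_one, zero_comp, zero_mul]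
  | one => rw [one_mul, sub_self, Polynomial.Chebyshev.S_zero, one_comp, one_mul]
  | add_two m ih1 ih2 =>
    have h := chebyshevC_mul_S (R := R) n (((m : ℤ) + 1) * n - 1)
    rw [show ((m : ℤ) + 1) * n - 1 + n = ((m : ℤ) + 2) * n - 1 by ring, show ((m : ℤ) + 1) * n - 1 - n = (m : ℤ) * n - 1 by ring] at h
    have h2 := congrArg (fun q => q.comp (Polynomial.Chebyshev.C R n)) (Polynomial.Chebyshev.S_add_two R ((m : ℤ) - 1))
    simp only [sub_comp, mul_comp, X_comp] at h2
    rw [show (m : ℤ) - 1 + 2 = (m : ℤ) + 2 - 1 by ring, show (m : ℤ) - 1 + 1 = (m : ℤ) + 1 - 1 by ring] at h2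
    rw [h2]
    linear_combination (-1 : R[X]) * h + Polynomial.Chebyshev.C R n * ih1 - ih2
  | neg_add_one m ih1 ih2 =>
    have h := chebyshevC_mul_S (R := R) n (-(m : ℤ) * n - 1)
    rw [show -(m : ℤ) * n - 1 + n = (-(m : ℤ) + 1) * n - 1 by ring, show -(m : ℤ) * n - 1 - n = (-(m : ℤ) - 1) * n - 1 by ring] at h
    have h2 := congrArg (fun q => q.comp (Polynomial.Chebyshev.C R n)) (Polynomial.Chebyshev.S_sub_one R (-(m : ℤ) - 1))
    simp only [sub_comp, mul_comp, X_comp] at h2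
    rw [show -(m : ℤ) - 1 + 1 = -(m : ℤ) + 1 - 1 by ring] at h2
    rw [h2]
    linear_combination (-1 : R[X]) * h + Polynomial.Chebyshev.C R n * ih1 - ih2

/-- **`S_{n−1} ∣ S_{mn−1}`** for all `m, n ∈ ℤ` (integer reading `U_n ∣ U_{mn}`: `Literature…LucasSequences.Subsequences`). [this file, §1252] -/
theorem chebyshevS_dvd_S_mul_pred {R : Type*} [CommRing R] (m n : ℤ) :
    Polynomial.Chebyshev.S R (n - 1) ∣ Polynomial.Chebyshev.S R (m * n - 1) :=
  ⟨(Polynomial.Chebyshev.S R (m - 1)).comp (Polynomial.Chebyshev.C R n), by rw [chebyshevS_mul_pred_eq_comp]; ring⟩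

/-- **Nested zero sets: every zero of `S_{n−1}` is a zero of `S_{mn−1}`** (`m, n ∈ ℤ`). [this file, §1252] -/
theorem chebyshevS_eval_eq_zero_of_eval_eq_zero {R : Type*} [CommRing R] (m n : ℤ) {x : R} (hx : (Polynomial.Chebyshev.S R (n - 1)).eval x = 0) :
    (Polynomial.Chebyshev.S R (m * n - 1)).eval x = 0 := by
  rw [chebyshevS_mul_pred_eq_comp, eval_mul, hx, mul_zero]

/-- The value form `S_{mn−1}(x) = S_{m−1}(C_n(x)) · S_{n−1}(x)` (Lehmer: `U_{mn} = U_m(V_n, 1) · U_n` for `Q = 1`). [Lehmer 1930 §2; this file, §1252] -/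
theorem chebyshevS_mul_pred_eval {R : Type*} [CommRing R] (m n : ℤ) (x : R) :
    (Polynomial.Chebyshev.S R (m * n - 1)).eval x = (Polynomial.Chebyshev.S R (m - 1)).eval ((Polynomial.Chebyshev.C R n).eval x) * (Polynomial.Chebyshev.S R (n - 1)).eval x := by
  rw [chebyshevS_mul_pred_eq_comp, eval_mul, eval_comp]

end Summit.Ventures.HSemireg.Wedge.HankelOuter
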